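import Mathlib
import Summits.Ventures.HodgeRepro.Tier4.Line4.LevelCongruenceLocal
import Summits.Ventures.HodgeRepro.Tier4.Line1.PlaneDefs
import Summits.Ventures.HodgeRepro.Tier4.Line1.LinRegular
import Summits.Ventures.HodgeRepro.Tier4.Line4.CentreCocompact
import Summits.Ventures.HodgeRepro.Tier4.Line4.SuppMeasure
import Summits.Ventures.HodgeRepro.Tier4.Line4.OrbitFibre
import Summits.Ventures.HodgeRepro.Tier4.Line4.LinRegularBlocks
import Summits.Ventures.HodgeRepro.Tier4.Line4.RatioReduce
import Summits.Ventures.HodgeRepro.Tier4.Line4.CentreFinDomain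

/-!
# Tier4/Line4/LevelCongruence — P2 of the folded ratio (F): the `q`-adic congruence at `γ₀`, uniform over the double
coset `K(qⁿ) γ₀,f K(qⁿ)`

Blind re-derivation cell `pub-hodge-repro`, Tier 4 «prove the step» (README §9–§10), seat t4-L2-p3 (gen 5; plan-4 g5's
ruling S15514 after F-L4-PROJ-NONUNIFORM S15509; statement S15538).  Tree path
`lean/Summits/Ventures/HodgeRepro/Tier4/Line4/LevelCongruence.lean`.  Imports this seat's `LevelCongruenceLocal` (and
through it `UltrametricCoords`, `QadicBounds`), `LinRegularBlocks` (the non-zero rational blocks), L2-p1's `SuppMeasure` /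
`RatioReduce` (`suppSet`, `projSet`) and L2-p2's `CentreFinDomain` (`ZfIn`).

THE THEOREM (**`exists_centre_congr_of_mem_suppSet`**): for a genuine plane with non-degenerate `B`, a linearly regular
rational `γ₀` and a prime `q`, there is `c₀ = c₀(W, γ₀, q)` such that for `n > c₀`, every `x ∈ K(qⁿ) γ₀,f K(qⁿ)` and
every `(c, c′) ∈ T_f × T′_f` with `c⁻¹ x c′ ∈ K(qⁿ) γ₀,f K(qⁿ)` are, modulo ONE central finite-part scalar `z`,
congruent to `1` modulo `q^{n−c₀}` at every place `v ∣ q` (all entries of the `v`-components of `z⁻¹ c`, `z⁻¹ c′`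
within `|q^{n−c₀}|_v` of those of `1`).  **`exists_centre_congr_of_mem_projSet`**: the same for the `T_f`-projection
set, `b = z · b₁` with `z ∈ Z_f` and `b₁ ≡ 1 (mod q^{n−c₀})` at every `v ∣ q` — the shape (F-c) binds.

PROOF.  `c = Σ esc(u_i) P_i`, `c′ = Σ esc(u′_j) Q_j` with norm-one scalars (`exists_esc_decomp`,
`nrm_eq_one_of_unitary`); the blocks satisfy `P_i (c⁻¹ x c′) Q_j = esc(ū_i u′_j) · P_i x Q_j` (`block_eq'`); at
`v ∣ q` both `c⁻¹ x c′` and `x` are within `|q|_v^n · M` of `γ₀`, and the rational block `P_i γ₀ Q_j ≠ 0`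
(LinRegularBlocks) carries a rational coordinate matrix `R`, so `block_scalar_near_one` gives
`ū_i u′_j ≡ 1 (mod |q|_v^n · M⁵)` for all four `(i, j)`; the constant `M = (|q|_v⁻¹)^c` bounds every rational constant
at every `v ∣ q` uniformly (`exists_valued_le_inv_pow_family`).  Then `z := (escGA u₀)_f`,
`z⁻¹ c = P₀ + esc(ū₀ u₁) P₁` with `ū₀ u₁ = (ū₀ u′₀) · conj(ū₁ u′₀)`, and `z⁻¹ c′ = Σ esc(ū₀ u′_j) Q_j`; `c₀ := 8 c`.

No printed input is consumed.  HC_CM is NOT proved by anyone in this repository.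
-/

set_option autoImplicit false
noncomputable section
namespace Summit.Ventures.HodgeRepro.Tier4.Line4
open Summit.Ventures.HodgeRepro.Tier4 Summit.Ventures.HodgeRepro.Tier4.Common
  Summit.Ventures.HodgeRepro.Tier4.Line1 NumberField IsDedekindDomain Matrix
open scoped NumberField Pointwise

section Main
variable {k : Type} [Field k] [NumberField k] (W : PlaneData k)

/-- **P2 — THE `q`-ADIC CONGRUENCE AT `γ₀`, UNIFORM OVER THE DOUBLE COSET** (statement S15538). -/
theorem exists_centre_congr_of_mem_suppSet {d : k} (hΩ : W.Ω * W.Ω = -(d • (1 : Matrix (Fin 4) (Fin 4) k)))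
    (hd : ¬ IsSquare (-d)) (hΩB : W.Ω * W.B = -(W.B * W.Ωᵀ)) (hPB : ∀ i, W.P i * W.B = W.B * (W.P i)ᵀ)
    (hQB : ∀ j, W.Q j * W.B = W.B * (W.Q j)ᵀ) (hPr : ∀ i, (W.P i).rank = 2) (hQr : ∀ j, (W.Q j).rank = 2)
    (hB : W.B.det ≠ 0) (γ₀ : rationalPoints W) (hreg : IsLinRegular W γ₀) (q : ℕ) (hq : q.Prime) :
    ∃ c₀ : ℕ, ∀ n : ℕ, c₀ < n → ∀ x ∈ levelDoubleCoset W (q ^ n) (GA.ofFinPart W (γ₀ : GA W)),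
      ∀ (c : torusFin W) (c' : torusFin' W), (c, c') ∈ suppSet W (γ₀ : GA W) (q ^ n) x →
      ∃ z ∈ centre W, z ∈ finitePart W ∧
        ∀ v : HeightOneSpectrum (𝓞 k), (q : 𝓞 k) ∈ v.asIdeal →
          (∀ i j : Fin 4, Valued.v (((GA.finiteComponent W v (z⁻¹ * ((c : torusT W) : GA W)) :
              GL (Fin 4) (v.adicCompletion k)) : Matrix (Fin 4) (Fin 4) (v.adicCompletion k)) i j -
              (1 : Matrix (Fin 4) (Fin 4) (v.adicCompletion k)) i j) ≤ natSize k v (q ^ (n - c₀))) ∧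
          (∀ i j : Fin 4, Valued.v (((GA.finiteComponent W v (z⁻¹ * ((c' : torusT' W) : GA W)) :
              GL (Fin 4) (v.adicCompletion k)) : Matrix (Fin 4) (Fin 4) (v.adicCompletion k)) i j -
              (1 : Matrix (Fin 4) (Fin 4) (v.adicCompletion k)) i j) ≤ natSize k v (q ^ (n - c₀))) := by
  classical
  -- the rational matrix of `γ₀` and its non-zero blocks
  obtain ⟨g₀, hg₀⟩ := exists_adMat_eq_mat W γ₀
  have hblock : ∀ i j, W.P i * g₀ * W.Q j ≠ 0 := fun i j =>
    P_mul_mul_Q_ne_zero_of_isLinRegular W hΩ hd hPB hQB hPr hB γ₀ hreg hg₀ i j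
  choose j₀ hj₀ using fun i j => exists_col_ne_zero (hblock i j)
  choose R hR0 hR1 using fun i j => exists_coordMatrix W hΩ hd (hj₀ i j)
  -- the uniform constant
  obtain ⟨c, hc⟩ := exists_valued_le_inv_pow_family q hq
    (Sum.elim (fun p : Fin 4 × Fin 4 => g₀ p.1 p.2)
      (Sum.elim (fun p : Fin 2 × Fin 4 × Fin 4 => W.P p.1 p.2.1 p.2.2)
        (Sum.elim (fun p : Fin 2 × Fin 4 × Fin 4 => W.Q p.1 p.2.1 p.2.2)
          (Sum.elim (fun p : Fin 4 × Fin 4 => W.Ω p.1 p.2)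
            (Sum.elim (fun p : Fin 2 × Fin 2 × Fin 2 × Fin 4 => R p.1 p.2.1 p.2.2.1 p.2.2.2)
              (fun _ : Unit => d))))))
  refine ⟨8 * c, fun n hn x hx c₁ c₁' hmem => ?_⟩
  -- the decompositions of `c₁ ∈ T_f` and `c₁′ ∈ T′_f`
  have hc₁u := (mem_unitaryGroup W _).1 ((c₁ : torusT W) : GA W).2
  have hc₁'u := (mem_unitaryGroup W _).1 ((c₁' : torusT' W) : GA W).2
  have hc₁P : ∀ i, GA.mat W ((c₁ : torusT W) : GA W) * adMat k (W.P i) =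
      adMat k (W.P i) * GA.mat W ((c₁ : torusT W) : GA W) := by
    intro i
    fin_cases i
    · exact (c₁ : torusT W).2.1
    · exact (c₁ : torusT W).2.2
  have hc₁'Q : ∀ j, GA.mat W ((c₁' : torusT' W) : GA W) * adMat k (W.Q j) =
      adMat k (W.Q j) * GA.mat W ((c₁' : torusT' W) : GA W) := by
    intro j
    fin_cases j
    · exact (c₁' : torusT' W).2.1
    · exact (c₁' : torusT' W).2.2
  obtain ⟨u, w, hcdec₀⟩ := exists_esc_decomp W hΩ hd W.P W.P_comm hPr W.P_sum hc₁u.1 hc₁P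
  obtain ⟨u', w', hc'dec₀⟩ := exists_esc_decomp W hΩ hd W.Q W.Q_comm hQr W.Q_sum hc₁'u.1 hc₁'Q
  have hcdec : GA.mat W ((c₁ : torusT W) : GA W) =
      esc W (u 0) (w 0) * adMat k (W.P 0) + esc W (u 1) (w 1) * adMat k (W.P 1) := hcdec₀
  have hc'dec : GA.mat W ((c₁' : torusT' W) : GA W) =
      esc W (u' 0) (w' 0) * adMat k (W.Q 0) + esc W (u' 1) (w' 1) * adMat k (W.Q 1) := hc'dec₀
  have hn1 : ∀ i, nrm d (u i) (w i) = 1 := fun i =>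
    nrm_eq_one_of_unitary W hΩ hΩB hB W.P W.P_comm hPB W.P_idem hPr W.P_sum u w hcdec hc₁u.2 i
  have hn1' : ∀ j, nrm d (u' j) (w' j) = 1 := fun j =>
    nrm_eq_one_of_unitary W hΩ hΩB hB W.Q W.Q_comm hQB W.Q_idem hQr W.Q_sum u' w' hc'dec hc₁'u.2 j
  have hcinv : GA.mat W ((c₁ : torusT W) : GA W)⁻¹ =
      esc W (u 0) (-w 0) * adMat k (W.P 0) + esc W (u 1) (-w 1) * adMat k (W.P 1) :=
    mat_inv_of_decomp W hΩ W.P W.P_comm W.P_idem W.P_sum u w hn1 hcdec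
  -- the blocks of `y := c₁⁻¹ x_f c₁′`
  set y : GA W := (((c₁ : torusT W) : GA W))⁻¹ * GA.ofFinPart W x * ((c₁' : torusT' W) : GA W) with hy
  have hymem : y ∈ levelDoubleCoset W (q ^ n) (GA.ofFinPart W (γ₀ : GA W)) := hmem
  have hxΩ : GA.mat W (GA.ofFinPart W x) * adMat k W.Ω = adMat k W.Ω * GA.mat W (GA.ofFinPart W x) :=
    ((mem_unitaryGroup W _).1 (GA.ofFinPart W x).2).1
  have hblk : ∀ i j, adMat k (W.P i) * GA.mat W y * adMat k (W.Q j) =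
      esc W (u i * u' j - algebraMap k (Ad k) d * (-w i * w' j)) (u i * w' j + -w i * u' j) *
        (adMat k (W.P i) * GA.mat W (GA.ofFinPart W x) * adMat k (W.Q j)) := by
    intro i j
    rw [hy, block_eq' W (fun i => u i) (fun i => -w i) u' w' hcinv hc'dec hxΩ i j, esc_mul_esc W hΩ]
  -- the centre element
  set z : GA W := GA.ofFinPart W (escGA W hΩ hΩB (u 0) (w 0) (hn1 0)) with hz
  refine ⟨z, ofFinPart_mem_centre W (escGA_mem_centre W hΩ hΩB (u 0) (w 0) (hn1 0)),
    ofFinPart_mem_finitePart W _, fun v hqv => ?_⟩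
  -- ===== the local step at `v ∣ q` =====
  have hs0 : natSize k v q ≠ 0 := natSize_ne_zero k v hq.ne_zero
  have hs1 : natSize k v q < 1 := natSize_lt_one_of_mem k v hqv
  have hM1 : 1 ≤ (natSize k v q)⁻¹ ^ c := one_le_inv_natSize_pow v q c hq.ne_zero
  set s := natSize k v q with hs
  set M := s⁻¹ ^ c with hMdef
  -- the constant bounds at `v`
  have hgb : ∀ a b, Valued.v (algebraMap k (v.adicCompletion k) (g₀ a b)) ≤ M := fun a b => hc v hqv (Sum.inl (a, b))
  have hPb : ∀ i a b, Valued.v (algebraMap k (v.adicCompletion k) (W.P i a b)) ≤ M :=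
    fun i a b => hc v hqv (Sum.inr (Sum.inl (i, a, b)))
  have hQb : ∀ j a b, Valued.v (algebraMap k (v.adicCompletion k) (W.Q j a b)) ≤ M :=
    fun j a b => hc v hqv (Sum.inr (Sum.inr (Sum.inl (j, a, b))))
  have hΩb : ∀ a b, Valued.v (algebraMap k (v.adicCompletion k) (W.Ω a b)) ≤ M :=
    fun a b => hc v hqv (Sum.inr (Sum.inr (Sum.inr (Sum.inl (a, b)))))
  have hRb : ∀ i j a b, Valued.v (algebraMap k (v.adicCompletion k) (R i j a b)) ≤ M :=
    fun i j a b => hc v hqv (Sum.inr (Sum.inr (Sum.inr (Sum.inr (Sum.inl (i, j, a, b))))))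
  have hdb : Valued.v (algebraMap k (v.adicCompletion k) d) ≤ M :=
    hc v hqv (Sum.inr (Sum.inr (Sum.inr (Sum.inr (Sum.inr ())))))
  -- the scale
  have hN : natSize k v (q ^ n) = s ^ n := by rw [natSize_pow]
  set ε₀ : WithZero (Multiplicative ℤ) := M * M * (M * (natSize k v (q ^ n) * M) * M) with hε₀
  have hε₀eq : ε₀ = s ^ n * M ^ 5 := by
    rw [hε₀, hN]
    simp only [pow_succ, pow_zero, one_mul]
    ac_rfl
  have h5c : 5 * c ≤ n := by omega
  have h8c : 8 * c ≤ n := by omega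
  have hsmall : ε₀ < 1 := by
    rw [hε₀eq, hMdef, pow_mul_inv_pow_eq hs0 h5c]
    exact pow_lt_one₀ zero_le hs1 (by omega)
  have hε₀1 : ε₀ ≤ 1 := hsmall.le
  have hfinal : M * M * (M * ε₀) ≤ natSize k v (q ^ (n - 8 * c)) := by
    rw [natSize_pow, hε₀eq, ← hs]
    refine le_of_eq ?_
    calc M * M * (M * (s ^ n * M ^ 5)) = s ^ n * M ^ 8 := by
          simp only [pow_succ, pow_zero, one_mul]
          ac_rfl
      _ = s ^ (n - 8 * c) := by rw [hMdef, pow_mul_inv_pow_eq hs0 h8c]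
  have hε₀M : ε₀ ≤ M * ε₀ := by
    calc ε₀ = 1 * ε₀ := (one_mul _).symm
      _ ≤ M * ε₀ := mul_le_mul' hM1 le_rfl
  have hle_one : ∀ a : v.adicCompletion k, Valued.v (a - 1) ≤ ε₀ → Valued.v a ≤ 1 := by
    intro a ha
    calc Valued.v a = Valued.v ((a - 1) + 1) := by rw [sub_add_cancel]
      _ ≤ max (Valued.v (a - 1)) (Valued.v (1 : v.adicCompletion k)) := Valuation.map_add _ _ _
      _ ≤ 1 := max_le (ha.trans hε₀1) (by rw [map_one])
  -- the four block scalars are `≡ 1`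
  have hxf : GA.ofFinPart W x = x := by
    apply ofFinPart_eq_self_of_mem_finitePart
    obtain ⟨a, ha, b, hb, rfl⟩ := exists_eq_mul_of_mem_mul_singleton_mul W _ _ _ hx
    exact (finitePart W).mul_mem ((finitePart W).mul_mem (levelK_le_finitePart W _ ha)
      (ofFinPart_mem_finitePart W _)) (levelK_le_finitePart W _ hb)
  have hblk' : ∀ i j, adMat k (W.P i) * GA.mat W y * adMat k (W.Q j) =
      esc W (u i * u' j - algebraMap k (Ad k) d * (-w i * w' j)) (u i * w' j + -w i * u' j) *
        (adMat k (W.P i) * GA.mat W x * adMat k (W.Q j)) := by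
    intro i j
    rw [hblk i j, hxf]
  have hAB : ∀ i j, Valued.v (adComponentFin k v (u i * u' j - algebraMap k (Ad k) d * (-w i * w' j)) - 1) ≤ ε₀ ∧
      Valued.v (adComponentFin k v (u i * w' j + -w i * u' j)) ≤ ε₀ := fun i j =>
    block_scalar_near_one W v hg₀ i j (j₀ i j) (hR0 i j) (hR1 i j) hM1 hgb (hPb i) (hQb j) hΩb (hRb i j)
      hx hymem (hblk' i j) hsmall
  -- the local pieces
  have hΩv : ∀ l m, Valued.v ((W.Ω.map (algebraMap k (v.adicCompletion k))) l m) ≤ M := fun l m => hΩb l m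
  have hΩ2v := map_Omega_sq W v hΩ
  have hz_inv : (GA.mat W z⁻¹).map (adComponentFin k v) = (esc W (u 0) (-w 0)).map (adComponentFin k v) := by
    rw [hz, ← ofFinPart_inv, map_mat_ofFinPart, mat_escGA_inv]
  have hone : (1 : M4 k) = adMat k (W.P 0) + adMat k (W.P 1) := by rw [← adMat_add, W.P_sum, adMat_one]
  have hone' : (1 : M4 k) = adMat k (W.Q 0) + adMat k (W.Q 1) := by rw [← adMat_add, W.Q_sum, adMat_one]
  -- a local scalar `a • 1 + b • Ω_v` with `a ≡ 1`, `b ≡ 0` times a constant matrix: entries `≤ M · M · ε₀`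
  have hterm : ∀ (ε : WithZero (Multiplicative ℤ)) (a b : v.adicCompletion k) (Z : Matrix (Fin 4) (Fin 4) k),
      Valued.v (a - 1) ≤ ε → Valued.v b ≤ ε →
      (∀ l m, Valued.v ((Z.map (algebraMap k (v.adicCompletion k))) l m) ≤ M) →
      ∀ l m, Valued.v ((((a - 1) • (1 : Matrix (Fin 4) (Fin 4) (v.adicCompletion k)) +
        b • W.Ω.map (algebraMap k (v.adicCompletion k))) * Z.map (algebraMap k (v.adicCompletion k))) l m) ≤
        M * M * ε := by
    intro ε a b Z ha hb hZ l m
    have h1 : ∀ l m, Valued.v (((a - 1) • (1 : Matrix (Fin 4) (Fin 4) (v.adicCompletion k)) +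
        b • W.Ω.map (algebraMap k (v.adicCompletion k))) l m) ≤ M * ε := by
      intro l m
      refine (scalar_apply_le v hΩv _ _ l m).trans (max_le ?_ ?_)
      · calc Valued.v (a - 1) ≤ ε := ha
          _ = 1 * ε := (one_mul _).symm
          _ ≤ M * ε := mul_le_mul' hM1 le_rfl
      · calc Valued.v b * M ≤ ε * M := mul_le_mul' hb le_rfl
          _ = M * ε := mul_comm _ _
    calc Valued.v ((((a - 1) • (1 : Matrix (Fin 4) (Fin 4) (v.adicCompletion k)) +
          b • W.Ω.map (algebraMap k (v.adicCompletion k))) * Z.map (algebraMap k (v.adicCompletion k))) l m)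
        ≤ M * ε * M := vmul_apply_le v h1 hZ l m
      _ = M * M * ε := by ac_rfl
  have hsub1 : ∀ (X Y : v.adicCompletion k),
      X • (1 : Matrix (Fin 4) (Fin 4) (v.adicCompletion k)) + Y • W.Ω.map (algebraMap k (v.adicCompletion k)) - 1 =
        (X - 1) • (1 : Matrix (Fin 4) (Fin 4) (v.adicCompletion k)) + Y • W.Ω.map (algebraMap k (v.adicCompletion k)) := by
    intro X Y
    rw [sub_smul, one_smul]
    abel
  have hmap_one : (1 : M4 k).map (adComponentFin k v) = 1 := Matrix.map_one _ (map_zero _) (map_one _)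
  have hmsub : ∀ A B : M4 k, (A - B).map (adComponentFin k v) = A.map (adComponentFin k v) - B.map (adComponentFin k v) :=
    fun A B => Matrix.map_sub _ (map_sub _) A B
  have hmadd : ∀ A B : M4 k, (A + B).map (adComponentFin k v) = A.map (adComponentFin k v) + B.map (adComponentFin k v) :=
    fun A B => Matrix.map_add _ (map_add _) A B
  refine ⟨?_, ?_⟩
  · -- ===== `z⁻¹ c₁ = P₀ + esc(ū₀ u₁) P₁` =====
    -- the scalar identity `esc(ū₀) esc(u₁) = esc(A₀₀, B₀₀) · esc(A₁₀, −B₁₀)`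
    have hE : esc W (u 0) (-w 0) * esc W (u 1) (w 1) =
        esc W (u 0 * u' 0 - algebraMap k (Ad k) d * (-w 0 * w' 0)) (u 0 * w' 0 + -w 0 * u' 0) *
          esc W (u 1 * u' 0 - algebraMap k (Ad k) d * (-w 1 * w' 0)) (-(u 1 * w' 0 + -w 1 * u' 0)) := by
      have h1 : esc W (u 0 * u' 0 - algebraMap k (Ad k) d * (-w 0 * w' 0)) (u 0 * w' 0 + -w 0 * u' 0) =
          esc W (u 0) (-w 0) * esc W (u' 0) (w' 0) := (esc_mul_esc W hΩ _ _ _ _).symm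
      have h2 : esc W (u 1 * u' 0 - algebraMap k (Ad k) d * (-w 1 * w' 0)) (-(u 1 * w' 0 + -w 1 * u' 0)) =
          esc W (u 1) (w 1) * esc W (u' 0) (-w' 0) := by
        rw [esc_mul_esc W hΩ]
        congr 1 <;> ring
      have hcomm : esc W (u' 0) (w' 0) * esc W (u 1) (w 1) = esc W (u 1) (w 1) * esc W (u' 0) (w' 0) :=
        esc_mul_comm W _ _ _ (esc_mul_adMat_comm W _ _ rfl)
      rw [h1, h2]
      symm
      calc esc W (u 0) (-w 0) * esc W (u' 0) (w' 0) * (esc W (u 1) (w 1) * esc W (u' 0) (-w' 0))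
          = esc W (u 0) (-w 0) * (esc W (u' 0) (w' 0) * esc W (u 1) (w 1)) * esc W (u' 0) (-w' 0) := by
            simp only [mul_assoc]
        _ = esc W (u 0) (-w 0) * esc W (u 1) (w 1) * (esc W (u' 0) (w' 0) * esc W (u' 0) (-w' 0)) := by
            rw [hcomm]; simp only [mul_assoc]
        _ = esc W (u 0) (-w 0) * esc W (u 1) (w 1) := by
            rw [esc_mul_esc_conj_eq_one W hΩ (hn1' 0), mul_one]
    -- the adelic matrix identity for `esc(ū₀) · mat c₁ − 1`
    have hadel : esc W (u 0) (-w 0) * GA.mat W ((c₁ : torusT W) : GA W) - 1 =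
        (esc W (u 0) (-w 0) * esc W (u 1) (w 1) - 1) * adMat k (W.P 1) := by
      rw [hcdec, mul_add, ← mul_assoc, ← mul_assoc, esc_conj_mul_esc_eq_one W hΩ (hn1 0), one_mul]
      conv_lhs => rw [hone]
      noncomm_ring
    intro i j
    rw [finiteComponent_coe_eq, ← Matrix.sub_apply]
    have hmat : (GA.mat W (z⁻¹ * ((c₁ : torusT W) : GA W))).map (adComponentFin k v) - 1 =
        ((esc W (u 0 * u' 0 - algebraMap k (Ad k) d * (-w 0 * w' 0)) (u 0 * w' 0 + -w 0 * u' 0)).map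
            (adComponentFin k v) *
          (esc W (u 1 * u' 0 - algebraMap k (Ad k) d * (-w 1 * w' 0)) (-(u 1 * w' 0 + -w 1 * u' 0))).map
            (adComponentFin k v) - 1) * (W.P 1).map (algebraMap k (v.adicCompletion k)) := by
      rw [GA.mat_mul, Matrix.map_mul, hz_inv, ← Matrix.map_mul, ← hmap_one, ← hmsub, hadel, hE,
        Matrix.map_mul, hmsub, Matrix.map_mul, map_adMat, hmap_one]
    rw [hmat, map_esc, map_esc, map_neg, scalar_mul_scalar v hΩ2v, hsub1]
    -- the coefficients
    obtain ⟨hA00, hB00⟩ := hAB 0 0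
    obtain ⟨hA10, hB10⟩ := hAB 1 0
    set a00 := adComponentFin k v (u 0 * u' 0 - algebraMap k (Ad k) d * (-w 0 * w' 0)) with ha00
    set b00 := adComponentFin k v (u 0 * w' 0 + -w 0 * u' 0) with hb00
    set a10 := adComponentFin k v (u 1 * u' 0 - algebraMap k (Ad k) d * (-w 1 * w' 0)) with ha10
    set b10 := adComponentFin k v (u 1 * w' 0 + -w 1 * u' 0) with hb10
    have hcoef1 : Valued.v (a00 * a10 - algebraMap k (v.adicCompletion k) d * (b00 * -b10) - 1) ≤ M * ε₀ := by
      have hid : a00 * a10 - algebraMap k (v.adicCompletion k) d * (b00 * -b10) - 1 =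
          (a00 - 1) * a10 + (a10 - 1) + algebraMap k (v.adicCompletion k) d * (b00 * b10) := by ring
      rw [hid]
      refine (Valuation.map_add _ _ _).trans (max_le ((Valuation.map_add _ _ _).trans (max_le ?_ ?_)) ?_)
      · rw [map_mul]
        calc Valued.v (a00 - 1) * Valued.v a10 ≤ ε₀ * 1 := mul_le_mul' hA00 (hle_one a10 hA10)
          _ = ε₀ := mul_one _
          _ ≤ M * ε₀ := hε₀M
      · exact hA10.trans hε₀M
      · rw [map_mul, map_mul]
        calc Valued.v (algebraMap k (v.adicCompletion k) d) * (Valued.v b00 * Valued.v b10)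
            ≤ M * (ε₀ * 1) := mul_le_mul' hdb (mul_le_mul' hB00 (hB10.trans hε₀1))
          _ = M * ε₀ := by rw [mul_one]
    have hcoef2 : Valued.v (a00 * -b10 + b00 * a10) ≤ M * ε₀ := by
      refine (Valuation.map_add _ _ _).trans (max_le ?_ ?_)
      · rw [map_mul, Valuation.map_neg]
        calc Valued.v a00 * Valued.v b10 ≤ 1 * ε₀ := mul_le_mul' (hle_one a00 hA00) hB10
          _ = ε₀ := one_mul _
          _ ≤ M * ε₀ := hε₀M
      · rw [map_mul]
        calc Valued.v b00 * Valued.v a10 ≤ ε₀ * 1 := mul_le_mul' hB00 (hle_one a10 hA10)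
          _ = ε₀ := mul_one _
          _ ≤ M * ε₀ := hε₀M
    exact (hterm (M * ε₀) _ _ (W.P 1) hcoef1 hcoef2 (fun l m => hPb 1 l m) i j).trans hfinal
  · -- ===== `z⁻¹ c₁′ = Σ esc(ū₀ u′_j) Q_j` =====
    have hadel : esc W (u 0) (-w 0) * GA.mat W ((c₁' : torusT' W) : GA W) - 1 =
        esc W (u 0 * u' 0 - algebraMap k (Ad k) d * (-w 0 * w' 0) - 1) (u 0 * w' 0 + -w 0 * u' 0) *
            adMat k (W.Q 0) +
          esc W (u 0 * u' 1 - algebraMap k (Ad k) d * (-w 0 * w' 1) - 1) (u 0 * w' 1 + -w 0 * u' 1) *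
            adMat k (W.Q 1) := by
      rw [hc'dec, mul_add, ← mul_assoc, ← mul_assoc, esc_mul_esc W hΩ, esc_mul_esc W hΩ, ← esc_sub_one,
        ← esc_sub_one]
      conv_lhs => rw [hone']
      noncomm_ring
    intro i j
    rw [finiteComponent_coe_eq, ← Matrix.sub_apply]
    have hmat : (GA.mat W (z⁻¹ * ((c₁' : torusT' W) : GA W))).map (adComponentFin k v) - 1 =
        (esc W (u 0 * u' 0 - algebraMap k (Ad k) d * (-w 0 * w' 0) - 1) (u 0 * w' 0 + -w 0 * u' 0)).map
            (adComponentFin k v) * (W.Q 0).map (algebraMap k (v.adicCompletion k)) +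
          (esc W (u 0 * u' 1 - algebraMap k (Ad k) d * (-w 0 * w' 1) - 1) (u 0 * w' 1 + -w 0 * u' 1)).map
            (adComponentFin k v) * (W.Q 1).map (algebraMap k (v.adicCompletion k)) := by
      rw [GA.mat_mul, Matrix.map_mul, hz_inv, ← Matrix.map_mul, ← hmap_one, ← hmsub, hadel,
        hmadd, Matrix.map_mul, Matrix.map_mul, map_adMat, map_adMat]
    rw [hmat, map_esc, map_esc,
      map_sub (adComponentFin k v) (u 0 * u' 0 - algebraMap k (Ad k) d * (-w 0 * w' 0)) 1,
      map_sub (adComponentFin k v) (u 0 * u' 1 - algebraMap k (Ad k) d * (-w 0 * w' 1)) 1, map_one]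
    obtain ⟨hA00, hB00⟩ := hAB 0 0
    obtain ⟨hA01, hB01⟩ := hAB 0 1
    refine (vadd_apply_le v (hterm ε₀ _ _ (W.Q 0) hA00 hB00 (fun l m => hQb 0 l m))
      (hterm ε₀ _ _ (W.Q 1) hA01 hB01 (fun l m => hQb 1 l m)) i j).trans ?_
    calc M * M * ε₀ ≤ M * M * (M * ε₀) := mul_le_mul' le_rfl hε₀M
      _ ≤ _ := hfinal

end Main

section Corollary
variable {k : Type} [Field k] [NumberField k] (W : PlaneData k)

/-- **P2 for the projection set** (the shape (F-c) binds, L1-p4 S15641 (3) / plan-4 S15671): for `n > c₀` and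
`x ∈ K(qⁿ) γ₀,f K(qⁿ)`, every `b ∈ projSet γ₀ (qⁿ) x` is `z · b₁` with `z ∈ Z_f` (inside `T_f`) and `b₁ ∈ T_f`
congruent to `1` modulo `q^{n−c₀}` at every `v ∣ q`. -/
theorem exists_centre_congr_of_mem_projSet {d : k} (hΩ : W.Ω * W.Ω = -(d • (1 : Matrix (Fin 4) (Fin 4) k)))
    (hd : ¬ IsSquare (-d)) (hΩB : W.Ω * W.B = -(W.B * W.Ωᵀ)) (hPB : ∀ i, W.P i * W.B = W.B * (W.P i)ᵀ)
    (hQB : ∀ j, W.Q j * W.B = W.B * (W.Q j)ᵀ) (hPr : ∀ i, (W.P i).rank = 2) (hQr : ∀ j, (W.Q j).rank = 2)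
    (hB : W.B.det ≠ 0) (γ₀ : rationalPoints W) (hreg : IsLinRegular W γ₀) (q : ℕ) (hq : q.Prime) :
    ∃ c₀ : ℕ, ∀ n : ℕ, c₀ < n → ∀ x ∈ levelDoubleCoset W (q ^ n) (GA.ofFinPart W (γ₀ : GA W)),
      ∀ b ∈ projSet W (γ₀ : GA W) (q ^ n) x, ∃ z ∈ ZfIn W, ∃ b₁ : torusFin W, b = z * b₁ ∧
        ∀ v : HeightOneSpectrum (𝓞 k), (q : 𝓞 k) ∈ v.asIdeal →
          ∀ i j : Fin 4, Valued.v (((GA.finiteComponent W v ((b₁ : torusT W) : GA W) :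
              GL (Fin 4) (v.adicCompletion k)) : Matrix (Fin 4) (Fin 4) (v.adicCompletion k)) i j -
              (1 : Matrix (Fin 4) (Fin 4) (v.adicCompletion k)) i j) ≤ natSize k v (q ^ (n - c₀)) := by
  obtain ⟨c₀, hc₀⟩ := exists_centre_congr_of_mem_suppSet W hΩ hd hΩB hPB hQB hPr hQr hB γ₀ hreg q hq
  refine ⟨c₀, fun n hn x hx b hb => ?_⟩
  obtain ⟨b', hb'⟩ := hb
  obtain ⟨z, hzc, hzf, hz⟩ := hc₀ n hn x hx b b' hb'
  -- `z` as an element of `T_f`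
  have hzT : z ∈ torusT W := centre_le_torusT W hzc
  set zT : torusT W := ⟨z, hzT⟩ with hzT'
  have hzTf : zT ∈ torusFin W := Subgroup.mem_subgroupOf.2 hzf
  set zf : torusFin W := ⟨zT, hzTf⟩ with hzf'
  have hzZ : zf ∈ ZfIn W := by
    rw [ZfIn, Subgroup.mem_subgroupOf, Subgroup.mem_subgroupOf]
    exact hzc
  refine ⟨zf, hzZ, zf⁻¹ * b, by rw [mul_inv_cancel_left], fun v hqv => ?_⟩
  have hcoe : (((zf⁻¹ * b : torusFin W) : torusT W) : GA W) = z⁻¹ * ((b : torusT W) : GA W) := rfl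
  rw [hcoe]
  exact (hz v hqv).1

end Corollary

end Summit.Ventures.HodgeRepro.Tier4.Line4
end
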